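import Literature.NumberTheory.Automorphic.PicardCMUniverse
import Literature.NumberTheory.Automorphic.UnitaryGroupFormTransport
import Literature.NumberTheory.Automorphic.UnitaryGroupDirectSum
import HarnessLib

/-!
# Transport of hermitian data along a field isomorphism onto a subfield of `ℂ`: places, Gram
# matrices, complex images, totally positive lines and their frames

Cell `hodgecm-mathlib` (D-0151), fan A, crux `HLiu418` (stmt-HodgeConjecture-24832), node **GS-7b** of the GS line
(A-plan1 g7 KEY `gs7b-fieldrange-transport` v3; A-plan2 scope ruling 2026-08-28T20:45:35Z).  THEOREMS ONLY (no
definition, no named fact, no instance).  Namespace `Literature.NumberTheory.Automorphic.CodeField` (the «code field»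
of ★ `PicardCMUniverse`; a sub-namespace because `…Automorphic.UnitaryGroup` has its own `hermForm`, definitionally but
not syntactically the `ShimuraVarieties.hermForm` of ★ `IsTotallyPositive`, which every statement below means).

The GS-7 closer works with a rank-3 piece of the compact unitary Shimura tower whose datum lives over a subfield
`E' ⊆ ℂ` coded from the face's CM field `L` (embedding `ι`) by a ring isomorphism `e : L ≃+* E'` over `ι`
(`subtype ∘ e = ι`; e.g. `E' = ι(L)`, `e = ι.rangeRestrictFieldEquiv`), because [Liu2021, proof of Thm. 4.15]'s
detecting line (★ III-8′ `MR92Prop6Source`) is handed over THE DATUM'S subfield while the face pin wants `L`-rational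
frames (A-plan1's «E-opacity» finding).  Most of the transport ALREADY exists in ★ `PicardCMUniverse.lean`
(§«Coding», §«Transport») and is CITED, NOT restated: instances `PicardCM.numberField_fieldRange` /
`isCMField_fieldRange`; `PicardCM.conjRingHom_rangeRestrictFieldEquiv`; `PicardCM.mem_unitaryGroup_map_iff` /
`map_principalCongruenceSubgroup` / `isCongruenceSubgroup_map` / `torsionFree_map`; `PicardCM.hermForm_map_ringEquiv` /
`anisotropic_map_ringEquiv_iff` / `map_map_conj` / `map_transpose_mul_mul`.  This file adds ONLY what was missing
(elementary; the citations name the objects' source), generic over `e : L ≃+* E` and ring endomorphisms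
`σL`, `σE` with `σE ∘ e = e ∘ σL`:

* §1 PLACES: `mk (τ ∘ e) = mk (τ' ∘ e) ↔ mk τ = mk τ'`; every embedding of `L` factors through `e`.
* §2 GRAM MATRICES: `(Hm^e)^τ = Hm^{τ ∘ e}`; positive-definiteness OFF A PLACE transports
  (`posDef_map_ringEquiv_of_ne_iff`, extracted for any rank from the inline argument of ★ `PicardCode.ofHermitian`);
  hermitian symmetry of entries and Sylvester-signature statements transport.
* §3 COMPLEX IMAGES OF GROUPS: `(Γ.map GL(e)).map GL(j) = Γ.map GL(j ∘ e)`; entries / columns of `GL(e) B`.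
* §4 FRAMES: `ᵗσE(GL(e)B)·Hm^e·GL(e)B = (ᵗσL(B)·Hm·B)^e`, so `ᵗσ(B)·Hm·B = J⋆ ⊕ᶠ J⊥` transports (★ `finSum_map`);
  the positivity numeric `0 < Re τ(J⊥₀₀)` transports.
* §5 TOTALLY POSITIVE LINES, DEFINITION-FREE (A-plan2 (s2); A-p12/A-p03 consumer shapes): `W ⊆ E^m` and `W₀ ⊆ L^m`
  CORRESPOND along `e` when `∀ v, v ∈ W₀ ↔ e ∘ v ∈ W`; such `W₀` exists, and then `IsTotallyPositive σE (Hm^e) W ↔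
  IsTotallyPositive σL Hm W₀`, `finrank_L W₀ = finrank_E W` (`lift_rank_eq_of_equiv_equiv`), membership / spans /
  «`∀ w ∈ W`»-clauses read back on `W₀`; no `Submodule.map` along a semilinear map enters any statement.
* §6 SUBFIELD CODES `e : L ≃+* E'`, `E' ⊆ ℂ`, over `ι`: `conjRingHom E' (e x) = e (c x)`, the pins
  `(Hm^e)^{subtype} = Hm^ι`, `(Γ.map GL(e)).map GL(subtype) = Γ.map GL(ι)`, places / `posDef_of_ne` / signature over
  `E'`, and the CONSUMER ENTRY POINT: a totally positive `E'`-line for `Hm^e` is the image of a totally positive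
  `L`-line for `Hm`, on which ★ `exists_frame_formCongr_eq_finSum_of_isTotallyPositive_of_isHermitian` runs over `L`.

Nothing about Shimura varieties is asserted.  Objects: ★ `ShimuraVarieties.{hermForm, IsTotallyPositive, conjRingHom}`
(`UnitaryBallQuotientDatum.lean`), ★ `formCongr` (`UnitaryGroupFormTransport.lean`), ★ `UnitaryGroup.finSum`.

## References (objects only; the statements are folklore linear algebra / field theory)
* [BergeronMillsonMoeglin2016Balls] N. Bergeron, J. Millson, C. Moeglin, Acta Math. 216 (2016), Part 2 §§1.1–1.2, §3.1.
* [Liu2021] Y. Liu, proof of Thm. 4.15 (the detecting totally positive line; consumer context only).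
-/

noncomputable section

open NumberField

namespace Literature.NumberTheory.Automorphic

namespace CodeField

open Literature.AlgebraicGeometry.ShimuraVarieties (hermForm IsTotallyPositive conjRingHom)
open Literature.NumberTheory.Automorphic.PicardCM (map_map_conj map_transpose_mul_mul hermForm_map_ringEquiv
  conjRingHom_rangeRestrictFieldEquiv)
open UnitaryGroup (finSum finSum_map)
open scoped _root_.Matrix ComplexOrder

/-! ## §1 Infinite places along a ring isomorphism -/

section Places

variable {L E : Type*} [Field L] [Field E] (e : L ≃+* E)

/-- Complex conjugation of embeddings commutes with precomposition: `conj (τ ∘ e) = (conj τ) ∘ e`.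
[cite: BergeronMillsonMoeglin2016Balls, Part 2 §1.1] -/
theorem conjugate_comp_ringEquiv (τ : E →+* ℂ) :
    ComplexEmbedding.conjugate (τ.comp e.toRingHom) = (ComplexEmbedding.conjugate τ).comp e.toRingHom :=
  rfl

/-- **Places along a ring isomorphism**: two complex embeddings of `E` define the same infinite place iff their
pull-backs along `e : L ≃+* E` do (`mk φ = mk ψ ↔ φ = ψ ∨ conj φ = ψ`, and `e` is surjective).
[cite: BergeronMillsonMoeglin2016Balls, Part 2 §1.1] -/
theorem infinitePlace_mk_comp_ringEquiv_eq_iff (τ τ' : E →+* ℂ) :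
    InfinitePlace.mk (τ.comp e.toRingHom) = InfinitePlace.mk (τ'.comp e.toRingHom) ↔
      InfinitePlace.mk τ = InfinitePlace.mk τ' := by
  rw [InfinitePlace.mk_eq_iff, InfinitePlace.mk_eq_iff, conjugate_comp_ringEquiv,
    RingHom.cancel_right (f := e.toRingHom) e.surjective, RingHom.cancel_right (f := e.toRingHom) e.surjective]

/-- Every complex embedding of `L` factors through `e`: `σ = (σ ∘ e⁻¹) ∘ e`.
[cite: BergeronMillsonMoeglin2016Balls, Part 2 §1.1] -/
theorem comp_symm_comp_ringEquiv (σ : L →+* ℂ) : (σ.comp e.symm.toRingHom).comp e.toRingHom = σ :=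
  RingHom.ext fun x => by simp

end Places

/-! ## §2 Gram matrices: embeddings, positive-definiteness off a place, hermitian entries, signature -/

section Gram

variable {L E : Type*} [Field L] [Field E] (e : L ≃+* E) {m n : Type*}

/-- `(Hm^e)^τ = Hm^{τ ∘ e}`. [cite: BergeronMillsonMoeglin2016Balls, Part 2 §1.1] -/
theorem map_ringEquiv_map (Hm : Matrix m n L) (τ : E →+* ℂ) : (Hm.map e).map τ = Hm.map (τ.comp e.toRingHom) := by
  ext i j; rfl

/-- `Hm^σ = (Hm^e)^{σ ∘ e⁻¹}` for an embedding `σ` of `L`. [cite: BergeronMillsonMoeglin2016Balls, Part 2 §1.1] -/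
theorem map_eq_map_ringEquiv_map_comp_symm (Hm : Matrix m n L) (σ : L →+* ℂ) :
    Hm.map σ = (Hm.map e).map (σ.comp e.symm.toRingHom) := by
  ext i j; simp

/-- **Positive-definiteness off a place transports** along `e`: `Hm^τ` is positive definite at every embedding
`τ` of `L` off the place of `j ∘ e` iff `(Hm^e)^{τ'}` is at every embedding `τ'` of `E` off the place of `j`.
[cite: BergeronMillsonMoeglin2016Balls, Part 2 §1.1] -/
theorem posDef_map_ringEquiv_of_ne_iff {m : Type*} [Fintype m] (Hm : Matrix m m L) (j : E →+* ℂ) :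
    (∀ τ' : E →+* ℂ, InfinitePlace.mk τ' ≠ InfinitePlace.mk j → ((Hm.map e).map τ').PosDef) ↔
      ∀ τ : L →+* ℂ, InfinitePlace.mk τ ≠ InfinitePlace.mk (j.comp e.toRingHom) → (Hm.map τ).PosDef := by
  constructor
  · intro h τ hτ
    rw [map_eq_map_ringEquiv_map_comp_symm e Hm τ]
    refine h _ fun heq => hτ ?_
    rw [← comp_symm_comp_ringEquiv e τ, infinitePlace_mk_comp_ringEquiv_eq_iff, heq]
  · intro h τ' hτ'
    rw [map_ringEquiv_map]
    exact h _ fun heq => hτ' ((infinitePlace_mk_comp_ringEquiv_eq_iff e τ' j).1 heq)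

variable {σL : L →+* L} {σE : E →+* E}

/-- **Hermitian symmetry of entries transports**: `σE ((Hm^e) i j) = (Hm^e) j i ↔ σL (Hm i j) = Hm j i` when
`σE ∘ e = e ∘ σL`. [cite: BergeronMillsonMoeglin2016Balls, Part 2 §1.1] -/
theorem forall_map_ringEquiv_apply_eq_iff {m : Type*} (Hm : Matrix m m L) (hσ : ∀ x, σE (e x) = e (σL x)) :
    (∀ i j, σE ((Hm.map e) i j) = (Hm.map e) j i) ↔ ∀ i j, σL (Hm i j) = Hm j i := by
  refine forall_congr' fun i => forall_congr' fun j => ?_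
  rw [Matrix.map_apply, Matrix.map_apply, hσ]
  exact e.injective.eq_iff

end Gram

/-! ## §3 Complex images of subgroups of `GL_m` -/

section Groups

variable {L E : Type*} [Field L] [Field E] (e : L ≃+* E) {m : Type*} [Fintype m] [DecidableEq m]

/-- The matrix of `GL(e) B` is `B.map e`. [cite: BergeronMillsonMoeglin2016Balls, Part 2 §1.2] -/
theorem coe_glMap_ringEquiv (B : GL m L) :
    ((Matrix.GeneralLinearGroup.map e.toRingHom B : GL m E) : Matrix m m E) = (B : Matrix m m L).map e :=
  rfl

/-- The `k`-th column of `GL(e) B` is `e ∘ (k-th column of B)`.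
[cite: BergeronMillsonMoeglin2016Balls, Part 2 §1.2] -/
theorem glMap_ringEquiv_col (B : GL m L) (k : m) :
    (fun i => ((Matrix.GeneralLinearGroup.map e.toRingHom B : GL m E) : Matrix m m E) i k) =
      ⇑e ∘ fun i => (B : Matrix m m L) i k :=
  rfl

/-- **Complex images compose**: `(Γ.map GL(e)).map GL(j) = Γ.map GL(j ∘ e)` for any further ring homomorphism
`j` (e.g. the inclusion of a subfield of `ℂ`). [cite: BergeronMillsonMoeglin2016Balls, Part 2 §1.2] -/
theorem subgroup_map_glMap_ringEquiv_map {R : Type*} [CommRing R] (Γ : Subgroup (GL m L)) (j : E →+* R) :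
    (Γ.map (Matrix.GeneralLinearGroup.map e.toRingHom)).map (Matrix.GeneralLinearGroup.map j) =
      Γ.map (Matrix.GeneralLinearGroup.map (j.comp e.toRingHom)) := by
  rw [Subgroup.map_map, ← Matrix.GeneralLinearGroup.map_comp]

end Groups

/-! ## §4 Frames: `formCongr`, block sums and columns along `e` -/

section Frames

variable {L E : Type*} [Field L] [Field E] (e : L ≃+* E) {σL : L →+* L} {σE : E →+* E}
  (hσ : ∀ x, σE (e x) = e (σL x)) {m : Type*} [Fintype m] [DecidableEq m]

include hσ in
/-- **The Gram matrix of a transported frame**: `ᵗσE(GL(e) B)·Hm^e·(GL(e) B) = (ᵗσL(B)·Hm·B)^e`.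
[cite: BergeronMillsonMoeglin2016Balls, Part 2 §3.1] -/
theorem formCongr_glMap_ringEquiv (B : GL m L) (Hm : Matrix m m L) :
    formCongr σE (Matrix.GeneralLinearGroup.map e.toRingHom B) (Hm.map e) = (formCongr σL B Hm).map e := by
  simp only [formCongr, coe_glMap_ringEquiv, map_map_conj e hσ, map_transpose_mul_mul]

include hσ in
/-- **Block decompositions transport**: if `ᵗσL(B)·Hm·B = J⋆ ⊕ᶠ J⊥` over `L` then
`ᵗσE(GL(e) B)·Hm^e·(GL(e) B) = J⋆^e ⊕ᶠ J⊥^e` over `E` (★ `UnitaryGroup.finSum_map`).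
[cite: BergeronMillsonMoeglin2016Balls, Part 2 §3.1] -/
theorem formCongr_glMap_ringEquiv_eq_finSum {N₁ N₂ : ℕ} (B : GL (Fin (N₁ + N₂)) L)
    (Hm : Matrix (Fin (N₁ + N₂)) (Fin (N₁ + N₂)) L) (Jstar : Matrix (Fin N₁) (Fin N₁) L)
    (Jperp : Matrix (Fin N₂) (Fin N₂) L) (hB : formCongr σL B Hm = finSum N₁ N₂ Jstar Jperp) :
    formCongr σE (Matrix.GeneralLinearGroup.map e.toRingHom B) (Hm.map e) =
      finSum N₁ N₂ (Jstar.map e) (Jperp.map e) := by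
  rw [formCongr_glMap_ringEquiv e hσ, hB]
  exact finSum_map (e : L →+* E) Jstar Jperp

/-- **Total positivity of a scalar transports**: `0 < Re τ(x)` at every embedding `τ` of `L` iff `0 < Re τ'(e x)` at
every embedding `τ'` of `E` (e.g. the numeric `J⊥₀₀ = ⟨w, w⟩` of a line frame).
[cite: BergeronMillsonMoeglin2016Balls, Part 2 §3.1] -/
theorem forall_re_pos_iff_forall_re_pos_ringEquiv (x : L) :
    (∀ τ : L →+* ℂ, 0 < (τ x).re) ↔ ∀ τ' : E →+* ℂ, 0 < (τ' (e x)).re := by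
  constructor
  · intro h τ'
    exact h (τ'.comp e.toRingHom)
  · intro h τ
    have h1 := h (τ.comp e.symm.toRingHom)
    simpa using h1

end Frames

/-! ## §5 Totally positive lines along `e`, definition-free -/

section Lines

variable {L E : Type*} [Field L] [Field E] (e : L ≃+* E) {m : Type*}

/-- `e ∘ (e⁻¹ ∘ u) = u`. [cite: BergeronMillsonMoeglin2016Balls, Introduction §1.7 and Part 2 §3.1] -/
theorem ringEquiv_comp_symm_comp (u : m → E) : (⇑e ∘ (⇑e.symm ∘ u)) = u :=
  funext fun i => e.apply_symm_apply (u i)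

/-- `e⁻¹ ∘ (e ∘ v) = v`. [cite: BergeronMillsonMoeglin2016Balls, Introduction §1.7 and Part 2 §3.1] -/
theorem ringEquiv_symm_comp_comp (v : m → L) : (⇑e.symm ∘ (⇑e ∘ v)) = v :=
  funext fun i => e.symm_apply_apply (v i)

/-- `e ∘ v = 0 ↔ v = 0`. [cite: BergeronMillsonMoeglin2016Balls, Introduction §1.7 and Part 2 §3.1] -/
theorem ringEquiv_comp_eq_zero_iff (v : m → L) : (⇑e ∘ v) = 0 ↔ v = 0 := by
  constructor
  · intro h
    funext i
    exact e.injective ((congrFun h i).trans (map_zero e).symm)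
  · rintro rfl
    funext i
    exact map_zero e

/-- **Every `E`-submodule of `E^m` corresponds along `e` to an `L`-submodule of `L^m`** (its pull-back by the
`e`-semilinear map `v ↦ e ∘ v`; stated without that map so that no `Submodule.map` along a semilinear equivalence
enters a consumer's statement). [cite: BergeronMillsonMoeglin2016Balls, Introduction §1.7 and Part 2 §3.1] -/
theorem exists_submodule_forall_mem_iff_comp_mem (W : Submodule E (m → E)) :
    ∃ W₀ : Submodule L (m → L), ∀ v : m → L, v ∈ W₀ ↔ (⇑e ∘ v) ∈ W := by
  let f : (m → L) →ₛₗ[(e : L →+* E)] (m → E) :=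
    { toFun := fun v => ⇑e ∘ v
      map_add' := fun v w => funext fun i => map_add e (v i) (w i)
      map_smul' := fun c v => funext fun i => map_mul e c (v i) }
  exact ⟨W.comap f, fun v => Iff.rfl⟩

variable {e} {W : Submodule E (m → E)} {W₀ : Submodule L (m → L)}
  (hW : ∀ v : m → L, v ∈ W₀ ↔ (⇑e ∘ v) ∈ W)

include hW in
/-- Membership read back along the correspondence: `u ∈ W ↔ e⁻¹ ∘ u ∈ W₀`.
[cite: BergeronMillsonMoeglin2016Balls, Introduction §1.7 and Part 2 §3.1] -/
theorem mem_iff_symm_comp_mem (u : m → E) : u ∈ W ↔ (⇑e.symm ∘ u) ∈ W₀ := by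
  rw [hW, ringEquiv_comp_symm_comp]

include hW in
/-- «`∀ w ∈ W`»-clauses read back on `W₀`: for any predicate `P` on `E`-vectors,
`(∀ u ∈ W, P u) ↔ ∀ v ∈ W₀, P (e ∘ v)`. [cite: BergeronMillsonMoeglin2016Balls, Introduction §1.7 and Part 2 §3.1] -/
theorem forall_mem_iff_forall_mem_comp (P : (m → E) → Prop) : (∀ u ∈ W, P u) ↔ ∀ v ∈ W₀, P (⇑e ∘ v) := by
  constructor
  · intro h v hv
    exact h _ ((hW v).1 hv)
  · intro h u hu
    have h1 := h (⇑e.symm ∘ u) ((mem_iff_symm_comp_mem hW u).1 hu)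
    rwa [ringEquiv_comp_symm_comp] at h1

include hW in
/-- **The `finrank` is preserved by the correspondence** (`Module.lift_rank_eq_of_equiv_equiv` for the additive
isomorphism `W₀ ≃+ W`, `w ↦ e ∘ w`, semilinear over the bijection `e`).
[cite: BergeronMillsonMoeglin2016Balls, Introduction §1.7 and Part 2 §3.1] -/
theorem finrank_eq_of_forall_mem_iff_comp_mem : Module.finrank L W₀ = Module.finrank E W := by
  let j : W₀ ≃+ W :=
    { toFun := fun w => ⟨⇑e ∘ (w : m → L), (hW _).1 w.2⟩
      invFun := fun u => ⟨⇑e.symm ∘ (u : m → E), (mem_iff_symm_comp_mem hW _).1 u.2⟩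
      left_inv := fun w => Subtype.ext (ringEquiv_symm_comp_comp e _)
      right_inv := fun u => Subtype.ext (ringEquiv_comp_symm_comp e _)
      map_add' := fun v w => Subtype.ext (funext fun i => map_add e _ _) }
  have hc : ∀ (r : L) (w : W₀), j (r • w) = e r • j w :=
    fun r w => Subtype.ext (funext fun i => map_mul e r ((w : m → L) i))
  have h := lift_rank_eq_of_equiv_equiv (⇑e) j e.bijective hc
  simpa [Module.finrank] using congrArg Cardinal.toNat h

variable (e) in
/-- Spans of corresponding vectors correspond: `v ∈ L ∙ w ↔ e ∘ v ∈ E ∙ (e ∘ w)`.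
[cite: BergeronMillsonMoeglin2016Balls, Introduction §1.7 and Part 2 §3.1] -/
theorem mem_span_singleton_iff_comp_mem_span_singleton (w v : m → L) :
    v ∈ Submodule.span L ({w} : Set (m → L)) ↔ (⇑e ∘ v) ∈ Submodule.span E ({⇑e ∘ w} : Set (m → E)) := by
  rw [Submodule.mem_span_singleton, Submodule.mem_span_singleton]
  constructor
  · rintro ⟨a, rfl⟩
    exact ⟨e a, funext fun i => by simp [map_mul]⟩
  · rintro ⟨b, hb⟩
    refine ⟨e.symm b, funext fun i => e.injective ?_⟩
    have hi := congrFun hb i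
    simp only [Pi.smul_apply, smul_eq_mul, Function.comp_apply] at hi ⊢
    rw [map_mul, e.apply_symm_apply]
    exact hi

include hW in
/-- If `W₀` corresponds to `W` and `W = E ∙ (e ∘ w)`, then `W₀ = L ∙ w`.
[cite: BergeronMillsonMoeglin2016Balls, Introduction §1.7 and Part 2 §3.1] -/
theorem eq_span_singleton_of_eq_span_singleton_comp (w : m → L)
    (h : W = Submodule.span E ({⇑e ∘ w} : Set (m → E))) : W₀ = Submodule.span L ({w} : Set (m → L)) := by
  ext v
  rw [hW, h, mem_span_singleton_iff_comp_mem_span_singleton e]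

variable [Fintype m] {σL : L →+* L} {σE : E →+* E} (hσ : ∀ x, σE (e x) = e (σL x)) (Hm : Matrix m m L)

include hσ in
/-- Form values transport (★ `PicardCM.hermForm_map_ringEquiv`, respelled with `Hm.map e`).
[cite: BergeronMillsonMoeglin2016Balls, Introduction §1.7 and Part 2 §3.1] -/
theorem hermForm_map_comp_comp (u v : m → L) :
    hermForm σE (Hm.map e) (⇑e ∘ u) (⇑e ∘ v) = e (hermForm σL Hm u v) := by
  simpa only [RingEquiv.toRingHom_eq_coe, RingHom.coe_coe] using hermForm_map_ringEquiv e hσ Hm u v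

include hW hσ in
/-- **Total positivity transports along the correspondence**: `W` is totally positive definite for `Hm^e` (and
`σE`) iff `W₀` is for `Hm` (and `σL`) — every embedding of `L` is `τ' ∘ e`, and `⟨e∘w, e∘w⟩ = e⟨w, w⟩`.
[cite: BergeronMillsonMoeglin2016Balls, Introduction §1.7 and Part 2 §3.1] -/
theorem isTotallyPositive_map_ringEquiv_iff :
    IsTotallyPositive σE (Hm.map e) W ↔ IsTotallyPositive σL Hm W₀ := by
  constructor
  · intro h w hw hw0 τ
    have hew : (⇑e ∘ w) ∈ W := (hW w).1 hw
    have hew0 : (⇑e ∘ w) ≠ 0 := fun h0 => hw0 ((ringEquiv_comp_eq_zero_iff e w).1 h0)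
    have h1 := h _ hew hew0 (τ.comp e.symm.toRingHom)
    have h2 : (τ.comp e.symm.toRingHom) (hermForm σE (Hm.map e) (⇑e ∘ w) (⇑e ∘ w)) =
        τ (hermForm σL Hm w w) := by
      rw [hermForm_map_comp_comp hσ Hm w w, RingHom.comp_apply]
      simp
    rwa [h2] at h1
  · intro h u hu hu0 τ'
    have hw : (⇑e.symm ∘ u) ∈ W₀ := (mem_iff_symm_comp_mem hW u).1 hu
    have hw0 : (⇑e.symm ∘ u) ≠ 0 := by
      intro h0
      apply hu0
      rw [← ringEquiv_comp_symm_comp e u, h0]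
      exact funext fun i => map_zero e
    have h1 := h _ hw hw0 (τ'.comp e.toRingHom)
    have h2 : (τ'.comp e.toRingHom) (hermForm σL Hm (⇑e.symm ∘ u) (⇑e.symm ∘ u)) =
        τ' (hermForm σE (Hm.map e) u u) := by
      rw [RingHom.comp_apply, RingEquiv.toRingHom_eq_coe, RingHom.coe_coe,
        ← hermForm_map_comp_comp hσ Hm, ringEquiv_comp_symm_comp]
    rwa [h2] at h1

end Lines

section Entry

variable {L E : Type*} [Field L] [Field E] {m : Type*} [Fintype m] {σL : L →+* L} {σE : E →+* E}

/-- **Consumer entry point**: a totally positive definite `E`-LINE for `Hm^e` comes from a totally positive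
definite `L`-line for `Hm`, corresponding to it along `e`.
[cite: BergeronMillsonMoeglin2016Balls, Introduction §1.7 and Part 2 §3.1] -/
theorem exists_line_of_isTotallyPositive_map_ringEquiv (e : L ≃+* E) (hσ : ∀ x, σE (e x) = e (σL x))
    (Hm : Matrix m m L) (W : Submodule E (m → E))
    (hpos : IsTotallyPositive σE (Hm.map e) W) (h1 : Module.finrank E W = 1) :
    ∃ W₀ : Submodule L (m → L), (∀ v : m → L, v ∈ W₀ ↔ (⇑e ∘ v) ∈ W) ∧
      IsTotallyPositive σL Hm W₀ ∧ Module.finrank L W₀ = 1 := by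
  obtain ⟨W₀, hW₀⟩ := exists_submodule_forall_mem_iff_comp_mem e W
  exact ⟨W₀, hW₀, (isTotallyPositive_map_ringEquiv_iff hW₀ hσ Hm).1 hpos,
    (finrank_eq_of_forall_mem_iff_comp_mem hW₀).trans h1⟩

end Entry


/-! ## §6 Subfield codes: `E' ⊆ ℂ` with `e : L ≃+* E'` over `ι` (e.g. `E' = ι(L)`, `e = ι.rangeRestrictFieldEquiv`) -/

section SubfieldCode

variable {L : Type} [Field L] (ι : L →+* ℂ) {E' : Subfield ℂ} (e : L ≃+* E')
  (he : ∀ x, ((e x : E') : ℂ) = ι x)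

/-- For the code field `ι(L)` itself and Mathlib's `e = ι.rangeRestrictFieldEquiv`, the compatibility `he` is
definitional: `((e x : ι(L)) : ℂ) = ι x`. [cite: BergeronMillsonMoeglin2016Balls, Part 2 §1.1] -/
theorem coe_rangeRestrictFieldEquiv_apply (x : L) : ((ι.rangeRestrictFieldEquiv x : ι.fieldRange) : ℂ) = ι x :=
  rfl

include he in
/-- `subtype ∘ e = ι` as ring homomorphisms. [cite: BergeronMillsonMoeglin2016Balls, Part 2 §1.1] -/
theorem subtype_comp_ringEquiv_eq : E'.subtype.comp e.toRingHom = ι :=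
  RingHom.ext he

include he in
/-- Complex read-out of transported vectors: `(i ↦ ((e (v i)) : ℂ)) = ι ∘ v` (the spelling met in the `orthogonal`
clause of ★ `IsCompatibleSpecialSource`). [cite: BergeronMillsonMoeglin2016Balls, Part 2 §1.1] -/
theorem coe_comp_ringEquiv_comp {m : Type*} (v : m → L) : (fun i => ((e (v i) : E') : ℂ)) = ⇑ι ∘ v :=
  funext fun i => he (v i)

include he in
/-- **Places of a subfield code**: an embedding `τ` of `E'` lies on the place of the inclusion `E' ⊆ ℂ` iff `τ ∘ e`
lies on the place of `ι`. [cite: BergeronMillsonMoeglin2016Balls, Part 2 §1.1] -/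
theorem infinitePlace_mk_comp_ringEquiv_eq_mk_iff (τ : E' →+* ℂ) :
    InfinitePlace.mk (τ.comp e.toRingHom) = InfinitePlace.mk ι ↔ InfinitePlace.mk τ = InfinitePlace.mk E'.subtype := by
  have h : InfinitePlace.mk ι = InfinitePlace.mk (E'.subtype.comp e.toRingHom) :=
    congrArg InfinitePlace.mk (subtype_comp_ringEquiv_eq ι e he).symm
  rw [h]
  exact infinitePlace_mk_comp_ringEquiv_eq_iff e τ _

include he in
/-- **The complex Gram matrix is unchanged**: `(Hm^e)^{subtype} = Hm^ι` (the `Hℂ` pin of a re-datumed piece; any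
shape). [cite: BergeronMillsonMoeglin2016Balls, Part 2 §1.1] -/
theorem map_ringEquiv_map_subtype {m n : Type*} (Hm : Matrix m n L) : (Hm.map e).map E'.subtype = Hm.map ι := by
  ext i j; exact he _

include he in
/-- **Positive-definiteness off the distinguished place, over a subfield code**: `(Hm^e)^{τ'}` is positive definite at
every `τ'` off the place of the inclusion iff `Hm^τ` is at every `τ` off the place of `ι` (the `posDef_of_ne` field).
[cite: BergeronMillsonMoeglin2016Balls, Part 2 §1.1] -/
theorem posDef_map_ringEquiv_of_ne_subtype_iff {m : Type*} [Fintype m] (Hm : Matrix m m L) :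
    (∀ τ' : E' →+* ℂ, InfinitePlace.mk τ' ≠ InfinitePlace.mk E'.subtype → ((Hm.map e).map τ').PosDef) ↔
      ∀ τ : L →+* ℂ, InfinitePlace.mk τ ≠ InfinitePlace.mk ι → (Hm.map τ).PosDef := by
  rw [posDef_map_ringEquiv_of_ne_iff e Hm E'.subtype, subtype_comp_ringEquiv_eq ι e he]

include he in
/-- **Signature over a subfield code**: `∃ T, Tᴴ·(Hm^e)^{subtype}·T = S ↔ ∃ T, Tᴴ·Hm^ι·T = S` (the `signature_τ₁`
field, `S = signatureMatrix p`). [cite: BergeronMillsonMoeglin2016Balls, Part 2 §1.1] -/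
theorem exists_signature_map_ringEquiv_subtype_iff {k : Type*} [Fintype k] [DecidableEq k] (Hm : Matrix k k L)
    (S : Matrix k k ℂ) :
    (∃ T : GL k ℂ, (T : Matrix k k ℂ)ᴴ * (Hm.map e).map E'.subtype * (T : Matrix k k ℂ) = S) ↔
      ∃ T : GL k ℂ, (T : Matrix k k ℂ)ᴴ * Hm.map ι * (T : Matrix k k ℂ) = S := by
  rw [map_ringEquiv_map_subtype ι e he]

include he in
/-- **Complex image of a transported group**: `(Γ.map GL(e)).map GL(subtype) = Γ.map GL(ι)` (the `Γ`-image pin of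
a re-datumed piece; any rank). [cite: BergeronMillsonMoeglin2016Balls, Part 2 §1.1] -/
theorem subgroup_map_glMap_ringEquiv_map_subtype {m : Type*} [Fintype m] [DecidableEq m] (Γ : Subgroup (GL m L)) :
    (Γ.map (Matrix.GeneralLinearGroup.map e.toRingHom)).map (Matrix.GeneralLinearGroup.map E'.subtype) =
      Γ.map (Matrix.GeneralLinearGroup.map ι) := by
  rw [subgroup_map_glMap_ringEquiv_map, subtype_comp_ringEquiv_eq ι e he]

variable [NumberField L] [IsCMField L] [NumberField E'] [IsCMField E']

include he in
/-- **A subfield code intertwines the conjugations**: `conjRingHom E' (e x) = e (c x)` for the CM conjugation `c`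
of `L` — both sides are read in `ℂ` through `ι` (★ `embedding_conjRingHom`, `IsCMField.complexEmbedding_complexConj`);
for `e = ι.rangeRestrictFieldEquiv` this is ★ `PicardCM.conjRingHom_rangeRestrictFieldEquiv`.
[cite: BergeronMillsonMoeglin2016Balls, Part 2 §1.1] -/
theorem conjRingHom_ringEquiv_apply (x : L) : conjRingHom E' (e x) = e (IsCMField.complexConj L x) := by
  apply Subtype.ext
  have h1 := Literature.AlgebraicGeometry.ShimuraVarieties.embedding_conjRingHom E' E'.subtype (e x)
  rw [Subfield.coe_subtype] at h1
  rw [h1, he, he, IsCMField.complexEmbedding_complexConj]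

include he in
/-- **Hermitian entries over a subfield code**: `Hm^e` is hermitian for `conjRingHom E'` iff `Hm` is for the CM
conjugation of `L`. [cite: BergeronMillsonMoeglin2016Balls, Part 2 §1.1] -/
theorem forall_conjRingHom_map_ringEquiv_apply_iff {m : Type*} (Hm : Matrix m m L) :
    (∀ i j, conjRingHom E' ((Hm.map e) i j) = (Hm.map e) j i) ↔ ∀ i j, IsCMField.complexConj L (Hm i j) = Hm j i :=
  forall_map_ringEquiv_apply_eq_iff e Hm (σL := (IsCMField.complexConj L).toRingEquiv.toRingHom)
    (conjRingHom_ringEquiv_apply ι e he)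

include he in
/-- **Consumer entry point over a subfield code** ([Liu2021, proof of Thm. 4.15]'s detecting line, handed by ★
`MR92Prop6Source` over the datum's subfield `E' ⊆ ℂ`, pulled back to `L`): a totally positive definite `E'`-line for
`Hm^e` and `conjRingHom E'` comes from a totally positive definite `L`-line for `Hm` and the CM conjugation of `L`,
corresponding to it along `e`; on it the generic frame engine ★
`exists_frame_formCongr_eq_finSum_of_isTotallyPositive_of_isHermitian` runs over `L`.
[cite: Liu2021, proof of Thm. 4.15] [cite: BergeronMillsonMoeglin2016Balls, Introduction §1.7 and Part 2 §3.1] -/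
theorem exists_line_of_isTotallyPositive_map_ringEquiv_subfield {m : Type*} [Fintype m] (Hm : Matrix m m L)
    (W : Submodule E' (m → E')) (hpos : IsTotallyPositive (conjRingHom E') (Hm.map e) W)
    (h1 : Module.finrank E' W = 1) :
    ∃ W₀ : Submodule L (m → L), (∀ v : m → L, v ∈ W₀ ↔ (⇑e ∘ v) ∈ W) ∧
      IsTotallyPositive (IsCMField.complexConj L).toRingEquiv.toRingHom Hm W₀ ∧ Module.finrank L W₀ = 1 :=
  exists_line_of_isTotallyPositive_map_ringEquiv e (σL := (IsCMField.complexConj L).toRingEquiv.toRingHom)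
    (conjRingHom_ringEquiv_apply ι e he) Hm W hpos h1

omit [NumberField E'] [IsCMField E'] in
/-- The same for the code field `ι(L)` and `e = ι.rangeRestrictFieldEquiv` (instances ★ `PicardCM.numberField_fieldRange`,
`PicardCM.isCMField_fieldRange`). [cite: Liu2021, proof of Thm. 4.15]
[cite: BergeronMillsonMoeglin2016Balls, Introduction §1.7 and Part 2 §3.1] -/
theorem exists_line_of_isTotallyPositive_map_rangeRestrictFieldEquiv {m : Type*} [Fintype m] (Hm : Matrix m m L)
    (W : Submodule ι.fieldRange (m → ι.fieldRange))
    (hpos : IsTotallyPositive (conjRingHom ι.fieldRange) (Hm.map ι.rangeRestrictFieldEquiv) W)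
    (h1 : Module.finrank ι.fieldRange W = 1) :
    ∃ W₀ : Submodule L (m → L), (∀ v : m → L, v ∈ W₀ ↔ (⇑ι.rangeRestrictFieldEquiv ∘ v) ∈ W) ∧
      IsTotallyPositive (IsCMField.complexConj L).toRingEquiv.toRingHom Hm W₀ ∧ Module.finrank L W₀ = 1 :=
  exists_line_of_isTotallyPositive_map_ringEquiv_subfield ι ι.rangeRestrictFieldEquiv (fun _ => rfl) Hm W hpos h1

end SubfieldCode

end CodeField

end Literature.NumberTheory.Automorphic

end
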